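import Literature.Probability.Percolation.FlipFourArm
import Literature.Probability.Percolation.LandedAltFourArm
import HarnessLib

/-!
# Four alternating arms force four disjoint interface crossings of the annulus

Topic: Probability / Percolation. The four-arm analogue of the "arms ⇒ interface" half of
`ArmEventsInterface.lean` (`exists_interfaceWalk_of_mem_armEvent_two`), the deterministic lattice
input of the scaling-limit statement (16) of S. Smirnov, W. Werner, *Critical exponents for
two-dimensional percolation*, Math. Res. Lett. **8** (2001), §4, for `j = 4` (the continuum input
`hlim` of `fourArm_exponent_of_altLimits`, `ArmExponentsFourArmInputs.lean`; C. Garban, G. Pete,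
O. Schramm, J. Amer. Math. Soc. 26 (2013), §2.4, Lemma 2.9: the alternating four-arm event is
read off the scaling limit): **on the alternating four-arm event `altFourArm r R` (cluster form,
`AltFourArm.lean`) there are four percolation interfaces — walks of the hexagonal lattice every
dart of which crosses an edge of `𝕋` with an open site on its left and a closed site on its
right, all these sites in the closed annulus `{r ≤ |·|_𝕋 ≤ R}` — crossing the annulus, two from a
face at `∂Λ_{r-1}` to a face at `∂Λ_{R+1}` and two the other way, with pairwise distinct crossed
edges** (`exists_four_interfaceWalks_of_mem_altFourArm`). Smirnov–Werner, Remark 6: the event of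
`b_j^{ep}` — the exploration process makes `j` crossings — is, for even `j = 2k`, "the probability
of `k` disjoint blue clusters" crossing the annulus, i.e. the alternating arrangement; Camia–Newman
2006, §4; Aizenman–Burchard 1999, App. A ("the `k` crossing segments cut the annulus into sectors").

Proof (winding numbers, no Jordan curve theorem; the template is the two-arm proof). Modify `ω`
off the annulus: `ω₁` is open on `Λ̊_r`, equals `ω` on the annulus and is closed off `Λ_R`. Through
the dart `s₁ → x₁` at the foot of the first closed arm (`x₁ ∈ ∂Λ_r`, `s₁ ∼ x₁` of norm `r - 1`)
passes an interface loop `w` of `ω₁`; its polygon has winding number `1` about the open ball, the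
open arms and their tips, and `0` about the closed arms, their feet and every site off `Λ_R`
(transport along monochromatic chains, `loopWind_leftPt_sub_loopWind_rightPt`). Hence `w` crosses
the foot dart `s₃ → x₃` of the second closed arm and the tip darts `y₀ → z₀`, `y₂ → z₂` of the open
arms (`loopWind_triMeshPoint_eq_of_adj`): along `w` there are steps touching `Λ̊_r` ("low") and
steps touching `(Λ_R)ᶜ` ("high"). **The cluster form forces the pattern low–high–low–high along
the loop**: between the two low foot darts, on either side, some step is high — otherwise the
closed sites on the right of that stretch of `w` are a closed chain of the annulus joining the two
closed arms (`altFourArm` forbids it). Between consecutive low and high steps of the pattern, the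
stretch of `w` from the last step touching `Λ̊_r` to the first step touching `(Λ_R)ᶜ` (or the
reverse) crosses annulus edges only, on which `ω₁ = ω`: four such stretches, in four disjoint
ranges of steps of the simple loop `w`, hence with distinct crossed edges.

Everything is proved; no definitions and no named facts are introduced.

## References

* S. Smirnov, W. Werner, Math. Res. Lett. 8 (2001) 729–744, §4, (12), (15), (16), Remark 6
  [SmirnovWernerMRL2001].
* C. Garban, G. Pete, O. Schramm, J. Amer. Math. Soc. 26 (2013), §2.4 Lemma 2.9 (arXiv 1008.1378)
  [GarbanPeteSchramm2013Pivotal].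
* F. Camia, C. M. Newman, Comm. Math. Phys. 268 (2006), §4 [CamiaNewman2006].
* M. Aizenman, A. Burchard, Duke Math. J. 99 (1999), Appendix A [AizenmanBurchardDuke1999].
-/

noncomputable section

open Set Metric Complex Filter MeasureTheory
open Literature.Topology.PlaneTopology Literature.Probability.RandomPlanarGeometry
open scoped unitInterval Topology

namespace Literature.Probability.Percolation

open LatticeModels

/-! ### Stretches of an interface loop between the two boundaries of the annulus -/

section Stretches

variable {ω₁ : SiteConfig (Site 2)} {f₀ : HexVertex} {w : hexGraph.Walk f₀ f₀} (hw : IsSiteInterfaceLoop ω₁ w)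
  {r R : ℕ}

/-- **Index bookkeeping, outward**: if step `i` of an interface loop touches `Λ̊_r` and a later
step `k` touches `(Λ_R)ᶜ`, there are `i ≤ j₁ < j₂ ≤ k` with step `j₁` touching `Λ̊_r`, step `j₂`
touching `(Λ_R)ᶜ`, and no step strictly between touching either (the first high step after `i`,
and the last low step before it). [folklore] -/
theorem IsSiteInterfaceLoop.exists_stretch_up {i k : ℕ} (hik : i ≤ k)
    (hi : triNorm (hw.lv i) < r ∨ triNorm (hw.rv i) < r)
    (hk : (R : ℤ) < triNorm (hw.lv k) ∨ (R : ℤ) < triNorm (hw.rv k)) (hrR : r ≤ R) :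
    ∃ j₁ j₂, i ≤ j₁ ∧ j₁ < j₂ ∧ j₂ ≤ k ∧
      (triNorm (hw.lv j₁) < r ∨ triNorm (hw.rv j₁) < r) ∧
      ((R : ℤ) < triNorm (hw.lv j₂) ∨ (R : ℤ) < triNorm (hw.rv j₂)) ∧
      ∀ j, j₁ < j → j < j₂ →
        ¬ (triNorm (hw.lv j) < r ∨ triNorm (hw.rv j) < r) ∧
        ¬ ((R : ℤ) < triNorm (hw.lv j) ∨ (R : ℤ) < triNorm (hw.rv j)) := by
  classical
  -- the first high step `≥ i`
  have hex : ∃ j, i ≤ j ∧ ((R : ℤ) < triNorm (hw.lv j) ∨ (R : ℤ) < triNorm (hw.rv j)) := ⟨k, hik, hk⟩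
  set j₂ := Nat.find hex with hj₂
  obtain ⟨hij₂, hj₂spec⟩ : i ≤ j₂ ∧ ((R : ℤ) < triNorm (hw.lv j₂) ∨ (R : ℤ) < triNorm (hw.rv j₂)) :=
    Nat.find_spec hex
  have hj₂min : ∀ j, i ≤ j → j < j₂ → ¬ ((R : ℤ) < triNorm (hw.lv j) ∨ (R : ℤ) < triNorm (hw.rv j)) :=
    fun j hij hj h ↦ Nat.find_min hex hj ⟨hij, h⟩
  have hj₂k : j₂ ≤ k := Nat.find_min' hex ⟨hik, hk⟩
  have hij₂' : i < j₂ := by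
    rcases eq_or_lt_of_le hij₂ with h | h
    · exfalso; rw [← h] at hj₂spec; rcases hi with hi | hi <;> rcases hj₂spec with h2 | h2 <;>
        · have := triNorm_nonneg (hw.lv i); have := triNorm_nonneg (hw.rv i)
          have h3 : triNorm (hw.rv i) ≤ triNorm (hw.lv i) + 1 ∧ triNorm (hw.lv i) ≤ triNorm (hw.rv i) + 1 := by
            by_cases hlen : i < w.length
            · have hadj := hw.adj_lv_rv hlen
              exact ⟨triNorm_le_triNorm_add_one_of_adj hadj, triNorm_le_triNorm_add_one_of_adj hadj.symm⟩
            · simp [IsSiteInterfaceLoop.lv, IsSiteInterfaceLoop.rv, hlen]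
          omega
    · exact h
  -- the last low step in `[i, j₂)`
  set P : ℕ → Prop := fun j ↦ i ≤ j ∧ (triNorm (hw.lv j) < r ∨ triNorm (hw.rv j) < r) with hP
  set j₁ := Nat.findGreatest P (j₂ - 1) with hj₁
  have hj₁le : j₁ ≤ j₂ - 1 := Nat.findGreatest_le _
  have hj₁spec : P j₁ := Nat.findGreatest_spec (P := P) (show i ≤ j₂ - 1 by omega) ⟨le_rfl, hi⟩
  have hj₁max : ∀ j, j₁ < j → j ≤ j₂ - 1 → ¬ P j := fun j h1 h2 ↦ Nat.findGreatest_is_greatest h1 h2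
  refine ⟨j₁, j₂, hj₁spec.1, by omega, hj₂k, hj₁spec.2, hj₂spec, fun j h1 h2 ↦ ⟨?_, ?_⟩⟩
  · intro h; exact hj₁max j h1 (by omega) ⟨by have := hj₁spec.1; omega, h⟩
  · exact hj₂min j (by have := hj₁spec.1; omega) h2

/-- **Index bookkeeping, inward**: if step `i` touches `(Λ_R)ᶜ` and a later step `k` touches
`Λ̊_r`, there are `i ≤ j₂ < j₁ ≤ k` with step `j₂` high, step `j₁` low and no step strictly between
touching either boundary region. [folklore] -/
theorem IsSiteInterfaceLoop.exists_stretch_down {i k : ℕ} (hik : i ≤ k)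
    (hi : (R : ℤ) < triNorm (hw.lv i) ∨ (R : ℤ) < triNorm (hw.rv i))
    (hk : triNorm (hw.lv k) < r ∨ triNorm (hw.rv k) < r) (hrR : r ≤ R) :
    ∃ j₂ j₁, i ≤ j₂ ∧ j₂ < j₁ ∧ j₁ ≤ k ∧
      ((R : ℤ) < triNorm (hw.lv j₂) ∨ (R : ℤ) < triNorm (hw.rv j₂)) ∧
      (triNorm (hw.lv j₁) < r ∨ triNorm (hw.rv j₁) < r) ∧
      ∀ j, j₂ < j → j < j₁ →
        ¬ (triNorm (hw.lv j) < r ∨ triNorm (hw.rv j) < r) ∧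
        ¬ ((R : ℤ) < triNorm (hw.lv j) ∨ (R : ℤ) < triNorm (hw.rv j)) := by
  classical
  have hex : ∃ j, i ≤ j ∧ (triNorm (hw.lv j) < r ∨ triNorm (hw.rv j) < r) := ⟨k, hik, hk⟩
  set j₁ := Nat.find hex with hj₁
  obtain ⟨hij₁, hj₁spec⟩ : i ≤ j₁ ∧ (triNorm (hw.lv j₁) < r ∨ triNorm (hw.rv j₁) < r) := Nat.find_spec hex
  have hj₁min : ∀ j, i ≤ j → j < j₁ → ¬ (triNorm (hw.lv j) < r ∨ triNorm (hw.rv j) < r) :=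
    fun j hij hj h ↦ Nat.find_min hex hj ⟨hij, h⟩
  have hj₁k : j₁ ≤ k := Nat.find_min' hex ⟨hik, hk⟩
  have hij₁' : i < j₁ := by
    rcases eq_or_lt_of_le hij₁ with h | h
    · exfalso; rw [← h] at hj₁spec; rcases hi with hi | hi <;> rcases hj₁spec with h2 | h2 <;>
        · have := triNorm_nonneg (hw.lv i); have := triNorm_nonneg (hw.rv i)
          have h3 : triNorm (hw.rv i) ≤ triNorm (hw.lv i) + 1 ∧ triNorm (hw.lv i) ≤ triNorm (hw.rv i) + 1 := by
            by_cases hlen : i < w.length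
            · have hadj := hw.adj_lv_rv hlen
              exact ⟨triNorm_le_triNorm_add_one_of_adj hadj, triNorm_le_triNorm_add_one_of_adj hadj.symm⟩
            · simp [IsSiteInterfaceLoop.lv, IsSiteInterfaceLoop.rv, hlen]
          omega
    · exact h
  set P : ℕ → Prop := fun j ↦ i ≤ j ∧ ((R : ℤ) < triNorm (hw.lv j) ∨ (R : ℤ) < triNorm (hw.rv j)) with hP
  set j₂ := Nat.findGreatest P (j₁ - 1) with hj₂
  have hj₂le : j₂ ≤ j₁ - 1 := Nat.findGreatest_le _
  have hj₂spec : P j₂ := Nat.findGreatest_spec (P := P) (show i ≤ j₁ - 1 by omega) ⟨le_rfl, hi⟩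
  have hj₂max : ∀ j, j₂ < j → j ≤ j₁ - 1 → ¬ P j := fun j h1 h2 ↦ Nat.findGreatest_is_greatest h1 h2
  refine ⟨j₂, j₁, hj₂spec.1, by omega, hj₁k, hj₂spec.2, hj₁spec, fun j h1 h2 ↦ ⟨?_, ?_⟩⟩
  · exact hj₁min j (by have := hj₂spec.1; omega) h2
  · intro h; exact hj₂max j h1 (by omega) ⟨by have := hj₂spec.1; omega, h⟩

/-- **Index bookkeeping, inward to the end of the loop**: if step `i` touches `(Λ_R)ᶜ` and no
later step touches `Λ̊_r`, there is a last high step `j₂ ≥ i`, after which no step touches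
either boundary region. [folklore] -/
theorem IsSiteInterfaceLoop.exists_stretch_down_end {i : ℕ}
    (hi : (R : ℤ) < triNorm (hw.lv i) ∨ (R : ℤ) < triNorm (hw.rv i))
    (hno : ∀ j, i < j → j < w.length → ¬ (triNorm (hw.lv j) < r ∨ triNorm (hw.rv j) < r)) :
    ∃ j₂, i ≤ j₂ ∧ j₂ < max (i + 1) w.length ∧
      ((R : ℤ) < triNorm (hw.lv j₂) ∨ (R : ℤ) < triNorm (hw.rv j₂)) ∧
      ∀ j, j₂ < j → j < w.length →
        ¬ (triNorm (hw.lv j) < r ∨ triNorm (hw.rv j) < r) ∧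
        ¬ ((R : ℤ) < triNorm (hw.lv j) ∨ (R : ℤ) < triNorm (hw.rv j)) := by
  classical
  set P : ℕ → Prop := fun j ↦ i ≤ j ∧ ((R : ℤ) < triNorm (hw.lv j) ∨ (R : ℤ) < triNorm (hw.rv j)) with hP
  set j₂ := Nat.findGreatest P (max (i + 1) w.length - 1) with hj₂
  have hj₂le : j₂ ≤ max (i + 1) w.length - 1 := Nat.findGreatest_le _
  have hj₂spec : P j₂ :=
    Nat.findGreatest_spec (P := P) (show i ≤ max (i + 1) w.length - 1 by omega) ⟨le_rfl, hi⟩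
  have hj₂max : ∀ j, j₂ < j → j ≤ max (i + 1) w.length - 1 → ¬ P j :=
    fun j h1 h2 ↦ Nat.findGreatest_is_greatest h1 h2
  refine ⟨j₂, hj₂spec.1, by omega, hj₂spec.2, fun j h1 h2 ↦ ⟨?_, ?_⟩⟩
  · exact hno j (by have := hj₂spec.1; omega) h2
  · intro h; exact hj₂max j h1 (by omega) ⟨by have := hj₂spec.1; omega, h⟩

/-- **The interface walk carried by a stretch of the loop.** If the steps `j₁ < j < j₂` of an
interface loop of `ω₁` (`j₂ ≤ length`) touch neither `Λ̊_r` nor `(Λ_R)ᶜ`, and `ω₁` agrees with `ω`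
on the closed annulus `{r ≤ |·|_𝕋 ≤ R}`, then the walk `w[j₁+1, j₂]` with the crossed darts of `w`
is an interface walk of `ω` all of whose crossed edges lie in the annulus. [folklore] -/
theorem IsSiteInterfaceLoop.exists_walk_of_stretch {ω : SiteConfig (Site 2)}
    (hagree : ∀ v, (r : ℤ) ≤ triNorm v → triNorm v ≤ R → (v ∈ ω₁ ↔ v ∈ ω))
    {j₁ j₂ : ℕ} (hj : j₁ < j₂) (hj₂ : j₂ ≤ w.length)
    (hann : ∀ j, j₁ < j → j < j₂ →
      ¬ (triNorm (hw.lv j) < r ∨ triNorm (hw.rv j) < r) ∧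
      ¬ ((R : ℤ) < triNorm (hw.lv j) ∨ (R : ℤ) < triNorm (hw.rv j))) :
    ∃ (p : hexGraph.Walk (w.getVert (j₁ + 1)) (w.getVert j₂)) (e : ℕ → triGraph.Dart),
      p.length = j₂ - 1 - j₁ ∧
      (∀ i < p.length, triEdgeFaces (e i) = (p.getVert (i + 1), p.getVert i) ∧ (e i).fst ∈ ω ∧ (e i).snd ∉ ω) ∧
      (∀ i < p.length, (r : ℤ) ≤ triNorm (e i).fst ∧ triNorm (e i).fst ≤ R ∧
        (r : ℤ) ≤ triNorm (e i).snd ∧ triNorm (e i).snd ≤ R) ∧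
      (∀ i < p.length, (e i).fst = hw.lv (j₁ + 1 + i) ∧ (e i).snd = hw.rv (j₁ + 1 + i)) := by
  have hlen : 0 < w.length := by omega
  set m := j₂ - 1 - j₁ with hm
  have hGv : (w.drop (j₁ + 1)).getVert m = w.getVert j₂ := by
    rw [SimpleGraph.Walk.drop_getVert]; congr 1; omega
  set p : hexGraph.Walk (w.getVert (j₁ + 1)) (w.getVert j₂) := ((w.drop (j₁ + 1)).take m).copy rfl hGv with hp
  have hplen : p.length = m := by
    rw [hp, SimpleGraph.Walk.length_copy, SimpleGraph.Walk.take_length, SimpleGraph.Walk.drop_length]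
    omega
  have hpget : ∀ k ≤ m, p.getVert k = w.getVert (j₁ + 1 + k) := by
    intro k hk
    rw [hp, SimpleGraph.Walk.getVert_copy, SimpleGraph.Walk.take_getVert, SimpleGraph.Walk.drop_getVert,
      min_eq_right hk]
  set e : ℕ → triGraph.Dart := fun k ↦ if h : j₁ + 1 + k < w.length then
    ⟨(hw.lv (j₁ + 1 + k), hw.rv (j₁ + 1 + k)), hw.adj_lv_rv h⟩ else ⟨(hw.lv 0, hw.rv 0), hw.adj_lv_rv hlen⟩ with he
  have hek : ∀ (k : ℕ) (hk : k < m), e k = ⟨(hw.lv (j₁ + 1 + k), hw.rv (j₁ + 1 + k)), hw.adj_lv_rv (by omega)⟩ := by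
    intro k hk
    simp only [he, dif_pos (show j₁ + 1 + k < w.length by omega)]
  have hann' : ∀ k, k < m → (r : ℤ) ≤ triNorm (hw.lv (j₁ + 1 + k)) ∧ triNorm (hw.lv (j₁ + 1 + k)) ≤ R ∧
      (r : ℤ) ≤ triNorm (hw.rv (j₁ + 1 + k)) ∧ triNorm (hw.rv (j₁ + 1 + k)) ≤ R := by
    intro k hk
    obtain ⟨a, b⟩ := hann (j₁ + 1 + k) (by omega) (by omega)
    push Not at a b
    exact ⟨a.1, b.1, a.2, b.2⟩
  refine ⟨p, e, hplen, ?_, ?_, ?_⟩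
  · intro k hk
    rw [hplen] at hk
    have hJ : j₁ + 1 + k < w.length := by omega
    obtain ⟨h', hf, hl, hr'⟩ := hw.dart_spec hJ
    obtain ⟨a1, a2, a3, a4⟩ := hann' k hk
    rw [hek k hk, hpget k (by omega), hpget (k + 1) (by omega)]
    refine ⟨?_, ?_, ?_⟩
    · rw [show j₁ + 1 + (k + 1) = j₁ + 1 + k + 1 by omega]; exact hf
    · change hw.lv (j₁ + 1 + k) ∈ ω
      exact (hagree _ a1 a2).1 hl
    · change hw.rv (j₁ + 1 + k) ∉ ω
      exact fun h ↦ hr' ((hagree _ a3 a4).2 h)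
  · intro k hk
    rw [hplen] at hk
    rw [hek k hk]
    exact hann' k hk
  · intro k hk
    rw [hplen] at hk
    rw [hek k hk]
    exact ⟨rfl, rfl⟩

omit hw in
/-- A face met by a low step and by an annulus step has a vertex on `∂Λ_{r-1}`. [folklore] -/
theorem exists_vertex_norm_add_one_eq_of_face {F : HexVertex} {a u : Site 2}
    (ha : a ∈ hexFaceVertices F) (hu : u ∈ hexFaceVertices F) (har : triNorm a < r)
    (hur : (r : ℤ) ≤ triNorm u) : ∃ v ∈ hexFaceVertices F, triNorm v + 1 = r := by
  have := triNorm_le_of_mem_hexFaceVertices ha hu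
  exact ⟨a, ha, by omega⟩

omit hw in
/-- A face met by a high step and by an annulus step has a vertex on `∂Λ_{R+1}`. [folklore] -/
theorem exists_vertex_norm_eq_add_one_of_face {F : HexVertex} {b u : Site 2}
    (hb : b ∈ hexFaceVertices F) (hu : u ∈ hexFaceVertices F) (hbR : (R : ℤ) < triNorm b)
    (huR : triNorm u ≤ R) : ∃ v ∈ hexFaceVertices F, triNorm v = R + 1 := by
  have := triNorm_le_of_mem_hexFaceVertices hu hb
  exact ⟨b, hb, by omega⟩

/-- **The right chain of a stretch of an interface loop.** If the right sites of the steps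
`j₀, …, j₁` all lie in `S`, they form a chain of `S` (consecutive right sites are equal or
adjacent). [folklore] -/
theorem IsSiteInterfaceLoop.pathIn_rv_of_mem {S : Set (Site 2)} {j₀ j₁ : ℕ} (h01 : j₀ ≤ j₁)
    (h1 : j₁ < w.length) (hS : ∀ j, j₀ ≤ j → j ≤ j₁ → hw.rv j ∈ S) :
    PathIn triGraph S (hw.rv j₀) (hw.rv j₁) := by
  induction j₁ with
  | zero =>
    obtain rfl : j₀ = 0 := by omega
    exact PathIn.refl (hS 0 le_rfl le_rfl)
  | succ j₁ ih =>
    rcases Nat.eq_or_lt_of_le h01 with h | h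
    · rw [← h]; exact PathIn.refl (hS j₀ le_rfl (by omega))
    · refine (ih (by omega) (by omega) fun j hj hj' ↦ hS j hj (by omega)).trans
        (PathIn.of_eq_or_adj (hS j₁ (by omega) (by omega)) (hS (j₁ + 1) h01 le_rfl) ?_)
      rcases hw.rv_succ_eq_or_adj h1 with h' | h'
      · exact Or.inl h'.symm
      · exact Or.inr h'

end Stretches

/-! ### The theorem -/

/-- **Four alternating arms force four disjoint interface crossings.** If
`ω ∈ altFourArm r R` (`1 ≤ r ≤ R`), there are four walks `p₀, …, p₃` of the hexagonal lattice, every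
dart of each crossing an edge of `𝕋` with an open site of `ω` on its left and a closed site on its
right, all these sites in the closed annulus `{r ≤ |·|_𝕋 ≤ R}`, `p₀` and `p₂` running from a face
with a vertex on `∂Λ_{r-1}` to a face with a vertex on `∂Λ_{R+1}`, `p₁` and `p₃` from a face with a
vertex on `∂Λ_{R+1}` to a face with a vertex on `∂Λ_{r-1}`, and the crossed darts of the four walks
pairwise distinct (Smirnov–Werner 2001, §4, Remark 6: for `j = 2k` the exploration hull makes `j`
crossings iff there are `k` disjoint blue crossing clusters; Camia–Newman 2006, §4). See the
module docstring for the proof. [cite: SmirnovWernerMRL2001, §4 Remark 6 and (15)–(16)] [cite: CamiaNewman2006, §4] -/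
theorem exists_four_interfaceWalks_of_mem_altFourArm {ω : SiteConfig (Site 2)} {r R : ℕ} (hr : 1 ≤ r)
    (hrR : r ≤ R) (hω : ω ∈ altFourArm r R) :
    ∃ (F G : Fin 4 → HexVertex) (p : ∀ k, hexGraph.Walk (F k) (G k)) (e : Fin 4 → ℕ → triGraph.Dart),
      (∀ k, ∀ i < (p k).length, triEdgeFaces (e k i) = ((p k).getVert (i + 1), (p k).getVert i) ∧
        (e k i).fst ∈ ω ∧ (e k i).snd ∉ ω) ∧
      (∀ k, ∀ i < (p k).length, (r : ℤ) ≤ triNorm (e k i).fst ∧ triNorm (e k i).fst ≤ R ∧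
        (r : ℤ) ≤ triNorm (e k i).snd ∧ triNorm (e k i).snd ≤ R) ∧
      ((∃ v ∈ hexFaceVertices (F 0), triNorm v + 1 = r) ∧ (∃ v ∈ hexFaceVertices (G 0), triNorm v = R + 1) ∧
        (∃ v ∈ hexFaceVertices (F 1), triNorm v = R + 1) ∧ (∃ v ∈ hexFaceVertices (G 1), triNorm v + 1 = r) ∧
        (∃ v ∈ hexFaceVertices (F 2), triNorm v + 1 = r) ∧ (∃ v ∈ hexFaceVertices (G 2), triNorm v = R + 1) ∧
        (∃ v ∈ hexFaceVertices (F 3), triNorm v = R + 1) ∧ (∃ v ∈ hexFaceVertices (G 3), triNorm v + 1 = r)) ∧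
      (∀ k k', k ≠ k' → ∀ i < (p k).length, ∀ i' < (p k').length, e k i ≠ e k' i') := by
  classical
  obtain ⟨x, y, wk, hwk, hdisj, -, hcc⟩ := hω
  have hxn : ∀ j, triNorm (x j) = r := fun j ↦ mem_triSphere_iff.1 (hwk j).1
  have hyn : ∀ j, triNorm (y j) = R := fun j ↦ mem_triSphere_iff.1 (hwk j).2.1
  have hsuppAnn : ∀ j, ∀ v ∈ (wk j).support, (r : ℤ) ≤ triNorm v ∧ triNorm v ≤ R :=
    fun j v hv ↦ mem_triAnn.1 (mem_triAnn_of_support hrR ((hwk j).2.2.2.1 v hv))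
  have hcolT : ∀ v ∈ (wk 0).support, v ∈ ω := fun v hv ↦ by simpa using (hwk 0).2.2.2.2 v hv
  have hcolF : ∀ v ∈ (wk 1).support, v ∉ ω := fun v hv ↦ by simpa using (hwk 1).2.2.2.2 v hv
  have hcolF' : ∀ v ∈ (wk 3).support, v ∉ ω := fun v hv ↦ by simpa using (hwk 3).2.2.2.2 v hv
  -- the modified configuration: open inside `Λ̊_r`, `ω` on the annulus, closed off `Λ_R`
  set ω₁ : SiteConfig (Site 2) := {v | triNorm v < r ∨ (v ∈ ω ∧ triNorm v ≤ R)} with hω₁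
  have hin : ∀ v, triNorm v < r → v ∈ ω₁ := fun v hv ↦ Or.inl hv
  have hout : ∀ v, (R : ℤ) < triNorm v → v ∈ ω₁ᶜ := fun v hv h ↦ by
    rcases h with h | h <;> omega
  have hclosed_ge : ∀ v, v ∉ ω₁ → (r : ℤ) ≤ triNorm v := fun v hv ↦ by
    by_contra h; exact hv (hin v (by omega))
  have hagree : ∀ v, (r : ℤ) ≤ triNorm v → triNorm v ≤ R → (v ∈ ω₁ ↔ v ∈ ω) := fun v h1 h2 ↦
    ⟨fun h ↦ h.elim (fun h ↦ absurd h1 (not_le.2 h)) (fun h ↦ h.1), fun h ↦ Or.inr ⟨h, h2⟩⟩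
  have hfin : ω₁.Finite := (triBall R).finite_toSet.subset fun v hv ↦ by
    rcases hv with hv | hv
    · exact Finset.mem_coe.2 (mem_triBall_iff.2 (by omega))
    · exact Finset.mem_coe.2 (mem_triBall_iff.2 hv.2)
  -- the closed arms inside `ω₁ᶜ`
  have hPc : ∀ j : Fin 4, (∀ v ∈ (wk j).support, v ∉ ω) →
      PathIn triGraph ({v | (r : ℤ) ≤ triNorm v ∧ triNorm v ≤ R} ∩ ω₁ᶜ) (x j) (y j) := fun j hcol ↦
    FourArmFlip.pathIn_of_walk (wk j) fun v hv ↦ ⟨hsuppAnn j v hv, fun h ↦ by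
      rcases h with h | h
      · exact absurd (hsuppAnn j v hv).1 (not_le.2 h)
      · exact hcol v hv h.1⟩
  have hPc1 := hPc 1 hcolF
  have hPc3 := hPc 3 hcolF'
  -- feet of the closed arms and tips
  have hx0 : ∀ j, x j ≠ 0 := fun j h ↦ by have := hxn j; rw [h, triNorm_zero] at this; omega
  obtain ⟨s₁, hxs₁, hs₁⟩ := exists_triGraph_adj_triNorm_add_one_eq (hx0 1)
  obtain ⟨s₃, hxs₃, hs₃⟩ := exists_triGraph_adj_triNorm_add_one_eq (hx0 3)
  obtain ⟨z₁, hyz₁, hz₁⟩ := exists_triGraph_adj_triNorm_eq_add_one (y 1)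
  obtain ⟨z₃, hyz₃, hz₃⟩ := exists_triGraph_adj_triNorm_eq_add_one (y 3)
  have hs₁ω : s₁ ∈ ω₁ := hin _ (by have := hxn 1; omega)
  have hx₁ω : x 1 ∉ ω₁ := (hPc1.left_mem).2
  have hx₃ω : x 3 ∉ ω₁ := (hPc3.left_mem).2
  -- the interface loop of `ω₁` through the dart `s₁ → x 1`
  obtain ⟨f₀, w, hw, hfaces⟩ := exists_isSiteInterfaceLoop_of_adj hfin hxs₁.symm hs₁ω hx₁ω
  have hlen : 0 < w.length := by have := hw.isCycle.three_le_length; omega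
  have hlr : hw.lv 0 = s₁ ∧ hw.rv 0 = x 1 := by
    obtain ⟨h', hfaces', -, -⟩ := hw.dart_spec hlen
    exact eq_of_triEdgeFaces_eq h' hxs₁.symm (hfaces'.trans hfaces.symm)
  -- winding numbers about the sites
  obtain ⟨ρ, hρ⟩ := exists_polyTrace_subset_closedBall hlen (1 : ℝ)
  have hWout : ∀ v, (R : ℤ) < triNorm v → loopWind 1 w (triMeshPoint 1 v) = 0 := by
    intro v hv
    obtain ⟨k, hk⟩ := exists_nat_gt (2 * ρ)
    obtain ⟨u, hu, hp⟩ := exists_pathIn_triNorm_eq_add hout hv k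
    have hWu : loopWind 1 w (triMeshPoint 1 u) = 0 := by
      refine loopWind_triMeshPoint_eq_zero_of_lt_norm one_pos hlen hρ ?_
      have h1 := mul_triNorm_le_norm_triEmbed u
      have h2 : (k : ℝ) ≤ triNorm u := by
        have : (k : ℤ) ≤ triNorm u := by rw [hu]; have := triNorm_nonneg v; omega
        exact_mod_cast this
      have h3 : (1 : ℝ) ≤ Real.sqrt 3 := Real.one_le_sqrt.2 (by norm_num)
      have h4 : (0 : ℝ) ≤ triNorm u := by exact_mod_cast triNorm_nonneg u
      nlinarith
    rw [← hWu]
    exact hw.loopWind_eq_of_pathIn_compl one_pos subset_rfl hp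
  -- the closed arms have winding number `0`
  have hWx : ∀ j : Fin 4, PathIn triGraph ({v | (r : ℤ) ≤ triNorm v ∧ triNorm v ≤ R} ∩ ω₁ᶜ) (x j) (y j) →
      ∀ z, triGraph.Adj (y j) z → triNorm z = triNorm (y j) + 1 → loopWind 1 w (triMeshPoint 1 (x j)) = 0 := by
    intro j hP z hyz hz
    have hP' : PathIn triGraph ω₁ᶜ (x j) (y j) := hP.mono Set.inter_subset_right
    rw [hw.loopWind_eq_of_pathIn_compl one_pos subset_rfl hP',
      hw.loopWind_triMeshPoint_eq_of_not_mem one_pos (Or.inr hyz) hP'.right_mem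
        (hout z (by rw [hz, hyn]; omega))]
    exact hWout z (by rw [hz, hyn]; omega)
  have hWx₁ : loopWind 1 w (triMeshPoint 1 (x 1)) = 0 := hWx 1 hPc1 z₁ hyz₁ hz₁
  have hWx₃ : loopWind 1 w (triMeshPoint 1 (x 3)) = 0 := hWx 3 hPc3 z₃ hyz₃ hz₃
  -- the open ball has winding number `1`
  have hjump := hw.loopWind_leftPt_sub_loopWind_rightPt one_pos hlen
  rw [IsSiteInterfaceLoop.leftPt, IsSiteInterfaceLoop.rightPt, hlr.1, hlr.2, hWx₁] at hjump
  have hWs₁ : loopWind 1 w (triMeshPoint 1 s₁) = 1 := by omega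
  have hWball : ∀ v, triNorm v < r → loopWind 1 w (triMeshPoint 1 v) = 1 := by
    intro v hv
    have hv0 : 0 ≤ triNorm v := triNorm_nonneg v
    rw [← hWs₁, hw.loopWind_eq_of_pathIn one_pos subset_rfl
        (pathIn_zero_of_triNorm_lt hin (r - 1) s₁ (by push_cast [hr]; have := hxn 1; omega) (by push_cast [hr]; omega)),
      ← hw.loopWind_eq_of_pathIn one_pos subset_rfl
        (pathIn_zero_of_triNorm_lt hin (triNorm v).toNat v (by omega) (by omega))]
  have hWs₃ : loopWind 1 w (triMeshPoint 1 s₃) = 1 := hWball s₃ (by have := hxn 3; omega)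
  -- so the loop crosses the foot dart `s₃ → x 3` of the second closed arm
  have hcross₃ : ∃ i < w.length, hw.lv i = s₃ ∧ hw.rv i = x 3 := by
    by_contra hno
    push Not at hno
    have := hw.loopWind_triMeshPoint_eq_of_adj one_pos (Or.inr hxs₃.symm) fun i hi ↦
      ⟨fun hh ↦ hno i hi hh.1.symm hh.2.symm, fun hh ↦ hx₃ω (hh.2 ▸ hw.lv_mem hi)⟩
    rw [hWs₃, hWx₃] at this
    exact one_ne_zero this
  obtain ⟨i₃, hi₃, hli₃, hri₃⟩ := hcross₃
  have hi₃0 : i₃ ≠ 0 := by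
    rintro rfl
    have h1 : x 3 = x 1 := hri₃.symm.trans hlr.2
    have hm1 : x 1 ∈ (wk 1).support := (wk 1).start_mem_support
    have hm3 : x 3 ∈ (wk 3).support := (wk 3).start_mem_support
    exact Finset.disjoint_left.1 (hdisj (show (1 : Fin 4) ≠ 3 by decide)) (List.mem_toFinset.2 hm1)
      (List.mem_toFinset.2 (h1 ▸ hm3))
  -- low and high steps
  have hlow0 : triNorm (hw.lv 0) < r ∨ triNorm (hw.rv 0) < r := Or.inl (by rw [hlr.1]; have := hxn 1; omega)
  have hlow₃ : triNorm (hw.lv i₃) < r ∨ triNorm (hw.rv i₃) < r := Or.inl (by rw [hli₃]; have := hxn 3; omega)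
  -- **the closed clause forces a high step on each side of `i₃`**
  have hchain : ∀ j₀ j₁, j₀ ≤ j₁ → j₁ < w.length →
      (∀ j, j₀ ≤ j → j ≤ j₁ → ¬ ((R : ℤ) < triNorm (hw.lv j) ∨ (R : ℤ) < triNorm (hw.rv j))) →
      PathIn triGraph (triAnn r R \ ω) (hw.rv j₀) (hw.rv j₁) := by
    intro j₀ j₁ h01 h1 hnoH
    refine hw.pathIn_rv_of_mem h01 h1 fun j hj0 hj1 ↦ ?_
    have hjlen : j < w.length := by omega
    have hcl : hw.rv j ∉ ω₁ := hw.rv_not_mem hjlen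
    have hge := hclosed_ge _ hcl
    have hle : triNorm (hw.rv j) ≤ R := by have := hnoH j hj0 hj1; push Not at this; exact this.2
    exact ⟨mem_triAnn.2 ⟨hge, hle⟩, fun h ↦ hcl ((hagree _ hge hle).2 h)⟩
  have hx1supp : x 1 ∈ (wk 1).support := (wk 1).start_mem_support
  have hx3supp : x 3 ∈ (wk 3).support := (wk 3).start_mem_support
  have hHa : ∃ a, 0 < a ∧ a < i₃ ∧ ((R : ℤ) < triNorm (hw.lv a) ∨ (R : ℤ) < triNorm (hw.rv a)) := by
    by_contra hno
    push Not at hno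
    have hnoH : ∀ j, 0 ≤ j → j ≤ i₃ → ¬ ((R : ℤ) < triNorm (hw.lv j) ∨ (R : ℤ) < triNorm (hw.rv j)) := by
      intro j _ hj h
      rcases Nat.eq_zero_or_pos j with h0 | h0
      · rw [h0, hlr.1, hlr.2] at h; have := hxn 1; omega
      · rcases eq_or_lt_of_le hj with h3 | h3
        · rw [h3, hli₃, hri₃] at h; have := hxn 3; omega
        · have h4 := hno j h0 h3
          rcases h with h | h
          · exact absurd h (not_lt.2 h4.1)
          · exact absurd h (not_lt.2 h4.2)
    have hp := hchain 0 i₃ (Nat.zero_le _) hi₃ hnoH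
    rw [hlr.2, hri₃] at hp
    exact hcc (x 1) hx1supp (x 3) hx3supp hp
  have hHc : ∃ c, i₃ < c ∧ c < w.length ∧ ((R : ℤ) < triNorm (hw.lv c) ∨ (R : ℤ) < triNorm (hw.rv c)) := by
    by_contra hno
    push Not at hno
    have hnoH : ∀ j, i₃ ≤ j → j ≤ w.length - 1 → ¬ ((R : ℤ) < triNorm (hw.lv j) ∨ (R : ℤ) < triNorm (hw.rv j)) := by
      intro j hj hj' h
      rcases eq_or_lt_of_le hj with h3 | h3
      · rw [← h3, hli₃, hri₃] at h; have := hxn 3; omega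
      · have h4 := hno j h3 (by omega)
        rcases h with h | h
        · exact absurd h (not_lt.2 h4.1)
        · exact absurd h (not_lt.2 h4.2)
    have hp := hchain i₃ (w.length - 1) (by omega) (by omega) hnoH
    rw [hri₃] at hp
    -- the last right site is a vertex of the base face, hence equal or adjacent to `x 1`
    have hlast : hw.rv (w.length - 1) ∈ hexFaceVertices f₀ := by
      have := hw.rv_mem_hexFaceVertices_succ (i := w.length - 1) (by omega)
      rwa [show w.length - 1 + 1 = w.length by omega, SimpleGraph.Walk.getVert_length] at this
    have hx1f : x 1 ∈ hexFaceVertices f₀ := by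
      have := hw.rv_mem_hexFaceVertices hlen
      rwa [hlr.2, SimpleGraph.Walk.getVert_zero] at this
    have hstep : PathIn triGraph (triAnn r R \ ω) (hw.rv (w.length - 1)) (x 1) := by
      refine PathIn.of_eq_or_adj hp.right_mem ?_ ?_
      · exact ⟨mem_triAnn.2 ⟨by have := hxn 1; omega, by have := hxn 1; omega⟩, hcolF _ hx1supp⟩
      · by_cases h : hw.rv (w.length - 1) = x 1
        · exact Or.inl h
        · exact Or.inr (adj_of_mem_hexFaceVertices hlast hx1f h)
    exact hcc (x 1) hx1supp (x 3) hx3supp (hp.trans hstep).symm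
  obtain ⟨a, ha0, hai, hHa⟩ := hHa
  obtain ⟨c, hic, hclen, hHc⟩ := hHc
  -- the four stretches
  obtain ⟨j₁, j₂, -, hj₁₂, hj₂a, hL₁, hH₂, hS0⟩ := hw.exists_stretch_up (Nat.zero_le a) hlow0 hHa hrR
  obtain ⟨k₂, k₁, hak₂, hk₂₁, hk₁i, hH₂', hL₁', hS1⟩ := hw.exists_stretch_down hai.le hHa hlow₃ hrR
  obtain ⟨l₁, l₂, hil₁, hl₁₂, hl₂c, hL₁'', hH₂'', hS2⟩ := hw.exists_stretch_up hic.le hlow₃ hHc hrR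
  -- the fourth stretch: down from `c`, either to a later low step or to the end of the loop
  have hS3 : ∃ m₂ m₁, c ≤ m₂ ∧ m₂ < m₁ ∧ m₁ ≤ w.length ∧
      ((R : ℤ) < triNorm (hw.lv m₂) ∨ (R : ℤ) < triNorm (hw.rv m₂)) ∧
      (m₁ < w.length → (triNorm (hw.lv m₁) < r ∨ triNorm (hw.rv m₁) < r)) ∧
      ∀ j, m₂ < j → j < m₁ →
        ¬ (triNorm (hw.lv j) < r ∨ triNorm (hw.rv j) < r) ∧
        ¬ ((R : ℤ) < triNorm (hw.lv j) ∨ (R : ℤ) < triNorm (hw.rv j)) := by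
    by_cases hlow : ∃ k, c < k ∧ k < w.length ∧ (triNorm (hw.lv k) < r ∨ triNorm (hw.rv k) < r)
    · obtain ⟨k, hck, hklen, hLk⟩ := hlow
      obtain ⟨m₂, m₁, hcm₂, hm₂₁, hm₁k, hH, hL, hS⟩ := hw.exists_stretch_down hck.le hHc hLk hrR
      exact ⟨m₂, m₁, hcm₂, hm₂₁, by omega, hH, fun _ ↦ hL, hS⟩
    · push Not at hlow
      obtain ⟨m₂, hcm₂, hm₂lt, hH, hS⟩ := hw.exists_stretch_down_end hHc fun j h1 h2 h ↦ by
        have h4 := hlow j h1 h2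
        rcases h with h | h
        · exact absurd h (not_lt.2 h4.1)
        · exact absurd h (not_lt.2 h4.2)
      exact ⟨m₂, w.length, hcm₂, by omega, le_rfl, hH, fun h ↦ absurd h (lt_irrefl _), fun j h1 h2 ↦ hS j h1 h2⟩
  obtain ⟨m₂, m₁, hcm₂, hm₂₁, hm₁len, hH₂x, hL₁x, hS3⟩ := hS3
  -- the index data of the four stretches
  set lo : Fin 4 → ℕ := ![j₁, k₂, l₁, m₂] with hlo
  set hi' : Fin 4 → ℕ := ![j₂, k₁, l₂, m₁] with hhi
  have hlohi : ∀ k, lo k < hi' k := by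
    intro k; fin_cases k
    · change j₁ < j₂; omega
    · change k₂ < k₁; omega
    · change l₁ < l₂; omega
    · change m₂ < m₁; omega
  have hhilen : ∀ k, hi' k ≤ w.length := by
    intro k; fin_cases k
    · change j₂ ≤ w.length; omega
    · change k₁ ≤ w.length; omega
    · change l₂ ≤ w.length; omega
    · change m₁ ≤ w.length; omega
  have hsep : ∀ k k' : Fin 4, k < k' → hi' k ≤ lo k' := by
    intro k k' hlt
    fin_cases k <;> fin_cases k' <;> simp at hlt
    · change j₂ ≤ k₂; omega
    · change j₂ ≤ l₁; omega
    · change j₂ ≤ m₂; omega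
    · change k₁ ≤ l₁; omega
    · change k₁ ≤ m₂; omega
    · change l₂ ≤ m₂; omega
  have hSk : ∀ k, ∀ j, lo k < j → j < hi' k →
      ¬ (triNorm (hw.lv j) < r ∨ triNorm (hw.rv j) < r) ∧
      ¬ ((R : ℤ) < triNorm (hw.lv j) ∨ (R : ℤ) < triNorm (hw.rv j)) := by
    intro k; fin_cases k
    · exact hS0
    · exact hS1
    · exact hS2
    · exact hS3
  have key : ∀ k, ∃ (p : hexGraph.Walk (w.getVert (lo k + 1)) (w.getVert (hi' k))) (e : ℕ → triGraph.Dart),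
      p.length = hi' k - 1 - lo k ∧
      (∀ i < p.length, triEdgeFaces (e i) = (p.getVert (i + 1), p.getVert i) ∧ (e i).fst ∈ ω ∧ (e i).snd ∉ ω) ∧
      (∀ i < p.length, (r : ℤ) ≤ triNorm (e i).fst ∧ triNorm (e i).fst ≤ R ∧
        (r : ℤ) ≤ triNorm (e i).snd ∧ triNorm (e i).snd ≤ R) ∧
      (∀ i < p.length, (e i).fst = hw.lv (lo k + 1 + i) ∧ (e i).snd = hw.rv (lo k + 1 + i)) := fun k ↦
    hw.exists_walk_of_stretch hagree (hlohi k) (hhilen k) (hSk k)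
  choose p e hplen hiface hann hek using key
  refine ⟨fun k ↦ w.getVert (lo k + 1), fun k ↦ w.getVert (hi' k), p, e, hiface, hann, ?_, ?_⟩
  · -- the end faces
    -- a face after a low step, before annulus steps or a high step, touches `∂Λ_{r-1}`
    have startLow : ∀ {j jj : ℕ}, j < jj → jj < w.length →
        (triNorm (hw.lv j) < r ∨ triNorm (hw.rv j) < r) →
        ((R : ℤ) < triNorm (hw.lv jj) ∨ (R : ℤ) < triNorm (hw.rv jj)) →
        (∀ i, j < i → i < jj → ¬ (triNorm (hw.lv i) < r ∨ triNorm (hw.rv i) < r) ∧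
          ¬ ((R : ℤ) < triNorm (hw.lv i) ∨ (R : ℤ) < triNorm (hw.rv i))) →
        ∃ v ∈ hexFaceVertices (w.getVert (j + 1)), triNorm v + 1 = r := by
      intro j jj hjj hjjlen hL hH hS
      -- a vertex of norm `≥ r` in the face `j + 1`
      have hu : ∃ u ∈ hexFaceVertices (w.getVert (j + 1)), (r : ℤ) ≤ triNorm u := by
        rcases Nat.lt_or_ge (j + 1) jj with h | h
        · refine ⟨hw.lv (j + 1), hw.lv_mem_hexFaceVertices (by omega), ?_⟩
          have := (hS (j + 1) (by omega) h).1; push Not at this; exact this.1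
        · have e1 : j + 1 = jj := by omega
          rw [e1]
          rcases hH with h2 | h2
          · exact ⟨hw.lv jj, hw.lv_mem_hexFaceVertices hjjlen, by omega⟩
          · exact ⟨hw.rv jj, hw.rv_mem_hexFaceVertices hjjlen, by omega⟩
      obtain ⟨u, hu, hur⟩ := hu
      rcases hL with h1 | h1
      · exact exists_vertex_norm_add_one_eq_of_face (hw.lv_mem_hexFaceVertices_succ (by omega)) hu h1 hur
      · exact exists_vertex_norm_add_one_eq_of_face (hw.rv_mem_hexFaceVertices_succ (by omega)) hu h1 hur
    -- a face at a high step, after annulus steps or a low step, touches `∂Λ_{R+1}`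
    have endHigh : ∀ {j jj : ℕ}, j < jj → jj < w.length →
        (triNorm (hw.lv j) < r ∨ triNorm (hw.rv j) < r) →
        ((R : ℤ) < triNorm (hw.lv jj) ∨ (R : ℤ) < triNorm (hw.rv jj)) →
        (∀ i, j < i → i < jj → ¬ (triNorm (hw.lv i) < r ∨ triNorm (hw.rv i) < r) ∧
          ¬ ((R : ℤ) < triNorm (hw.lv i) ∨ (R : ℤ) < triNorm (hw.rv i))) →
        ∃ v ∈ hexFaceVertices (w.getVert jj), triNorm v = R + 1 := by
      intro j jj hjj hjjlen hL hH hS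
      have hu : ∃ u ∈ hexFaceVertices (w.getVert jj), triNorm u ≤ R := by
        rcases Nat.lt_or_ge (j + 1) jj with h | h
        · refine ⟨hw.lv (jj - 1), ?_, ?_⟩
          · have := hw.lv_mem_hexFaceVertices_succ (i := jj - 1) (by omega)
            rwa [show jj - 1 + 1 = jj by omega] at this
          · have := (hS (jj - 1) (by omega) (by omega)).2; push Not at this; exact this.1
        · have e1 : j + 1 = jj := by omega
          rw [← e1]
          rcases hL with h1 | h1
          · exact ⟨hw.lv j, hw.lv_mem_hexFaceVertices_succ (by omega), by omega⟩
          · exact ⟨hw.rv j, hw.rv_mem_hexFaceVertices_succ (by omega), by omega⟩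
      obtain ⟨u, hu, huR⟩ := hu
      rcases hH with h2 | h2
      · exact exists_vertex_norm_eq_add_one_of_face (hw.lv_mem_hexFaceVertices hjjlen) hu h2 huR
      · exact exists_vertex_norm_eq_add_one_of_face (hw.rv_mem_hexFaceVertices hjjlen) hu h2 huR
    -- the symmetric statements for inward stretches, allowing the stretch to end at the base face
    have startHigh : ∀ {j jj : ℕ}, j < jj → jj ≤ w.length →
        ((R : ℤ) < triNorm (hw.lv j) ∨ (R : ℤ) < triNorm (hw.rv j)) →
        (jj < w.length → triNorm (hw.lv jj) < r ∨ triNorm (hw.rv jj) < r) →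
        (jj = w.length → ∃ v ∈ hexFaceVertices (w.getVert jj), triNorm v < r) →
        (∀ i, j < i → i < jj → ¬ (triNorm (hw.lv i) < r ∨ triNorm (hw.rv i) < r) ∧
          ¬ ((R : ℤ) < triNorm (hw.lv i) ∨ (R : ℤ) < triNorm (hw.rv i))) →
        ∃ v ∈ hexFaceVertices (w.getVert (j + 1)), triNorm v = R + 1 := by
      intro j jj hjj hjjlen hH hL hend hS
      have hu : ∃ u ∈ hexFaceVertices (w.getVert (j + 1)), triNorm u ≤ R := by
        rcases Nat.lt_or_ge (j + 1) jj with h | h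
        · refine ⟨hw.lv (j + 1), hw.lv_mem_hexFaceVertices (by omega), ?_⟩
          have := (hS (j + 1) (by omega) h).2; push Not at this; exact this.1
        · have e1 : j + 1 = jj := by omega
          rw [e1]
          rcases Nat.lt_or_ge jj w.length with hjj' | hjj'
          · rcases hL hjj' with h2 | h2
            · exact ⟨hw.lv jj, hw.lv_mem_hexFaceVertices hjj', by omega⟩
            · exact ⟨hw.rv jj, hw.rv_mem_hexFaceVertices hjj', by omega⟩
          · obtain ⟨v, hv, hvr⟩ := hend (by omega)
            exact ⟨v, hv, by omega⟩
      obtain ⟨u, hu, huR⟩ := hu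
      rcases hH with h1 | h1
      · exact exists_vertex_norm_eq_add_one_of_face (hw.lv_mem_hexFaceVertices_succ (by omega)) hu h1 huR
      · exact exists_vertex_norm_eq_add_one_of_face (hw.rv_mem_hexFaceVertices_succ (by omega)) hu h1 huR
    have endLow : ∀ {j jj : ℕ}, j < jj → jj ≤ w.length →
        ((R : ℤ) < triNorm (hw.lv j) ∨ (R : ℤ) < triNorm (hw.rv j)) →
        (jj < w.length → triNorm (hw.lv jj) < r ∨ triNorm (hw.rv jj) < r) →
        (jj = w.length → ∃ v ∈ hexFaceVertices (w.getVert jj), triNorm v + 1 = r) →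
        (∀ i, j < i → i < jj → ¬ (triNorm (hw.lv i) < r ∨ triNorm (hw.rv i) < r) ∧
          ¬ ((R : ℤ) < triNorm (hw.lv i) ∨ (R : ℤ) < triNorm (hw.rv i))) →
        ∃ v ∈ hexFaceVertices (w.getVert jj), triNorm v + 1 = r := by
      intro j jj hjj hjjlen hH hL hend hS
      rcases Nat.lt_or_ge jj w.length with hjj' | hjj'
      · have hu : ∃ u ∈ hexFaceVertices (w.getVert jj), (r : ℤ) ≤ triNorm u := by
          rcases Nat.lt_or_ge (j + 1) jj with h | h
          · refine ⟨hw.lv (jj - 1), ?_, ?_⟩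
            · have := hw.lv_mem_hexFaceVertices_succ (i := jj - 1) (by omega)
              rwa [show jj - 1 + 1 = jj by omega] at this
            · have := (hS (jj - 1) (by omega) (by omega)).1; push Not at this; exact this.1
          · have e1 : j + 1 = jj := by omega
            rw [← e1]
            rcases hH with h1 | h1
            · exact ⟨hw.lv j, hw.lv_mem_hexFaceVertices_succ (by omega), by omega⟩
            · exact ⟨hw.rv j, hw.rv_mem_hexFaceVertices_succ (by omega), by omega⟩
        obtain ⟨u, hu, hur⟩ := hu
        rcases hL hjj' with h2 | h2
        · exact exists_vertex_norm_add_one_eq_of_face (hw.lv_mem_hexFaceVertices hjj') hu h2 hur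
        · exact exists_vertex_norm_add_one_eq_of_face (hw.rv_mem_hexFaceVertices hjj') hu h2 hur
      · exact hend (by omega)
    -- the base face touches `∂Λ_{r-1}` at `s₁`
    have hbase : ∀ jj, jj = w.length → ∃ v ∈ hexFaceVertices (w.getVert jj), triNorm v + 1 = r := by
      rintro jj rfl
      refine ⟨s₁, ?_, by have := hxn 1; omega⟩
      have := hw.lv_mem_hexFaceVertices hlen
      rw [hlr.1, SimpleGraph.Walk.getVert_zero] at this
      rw [SimpleGraph.Walk.getVert_length]
      exact this
    have hbase' : ∀ jj, jj = w.length → ∃ v ∈ hexFaceVertices (w.getVert jj), triNorm v < r := by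
      intro jj hjj
      obtain ⟨v, hv, hvr⟩ := hbase jj hjj
      exact ⟨v, hv, by omega⟩
    have hk₁len : k₁ < w.length := by omega
    have hj₂len : j₂ < w.length := by omega
    have hl₂len : l₂ < w.length := by omega
    refine ⟨?_, ?_, ?_, ?_, ?_, ?_, ?_, ?_⟩
    · exact startLow hj₁₂ hj₂len hL₁ hH₂ hS0
    · exact endHigh (jj := j₂) hj₁₂ hj₂len hL₁ hH₂ hS0
    · exact startHigh hk₂₁ hk₁len.le hH₂' (fun _ ↦ hL₁') (fun h ↦ absurd h (by omega)) hS1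
    · exact endLow (jj := k₁) hk₂₁ hk₁len.le hH₂' (fun _ ↦ hL₁') (fun h ↦ absurd h (by omega)) hS1
    · exact startLow hl₁₂ hl₂len hL₁'' hH₂'' hS2
    · exact endHigh (jj := l₂) hl₁₂ hl₂len hL₁'' hH₂'' hS2
    · exact startHigh hm₂₁ hm₁len hH₂x hL₁x (hbase' m₁) hS3
    · exact endLow (jj := m₁) hm₂₁ hm₁len hH₂x hL₁x (hbase m₁) hS3
  · -- the crossed darts of different stretches are distinct: their step ranges are disjoint
    intro k k' hkk' i hi i' hi' heq
    have h1 := hek k i hi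
    have h2 := hek k' i' hi'
    rw [heq] at h1
    have hl : hw.lv (lo k + 1 + i) = hw.lv (lo k' + 1 + i') := h1.1.symm.trans h2.1
    have hr' : hw.rv (lo k + 1 + i) = hw.rv (lo k' + 1 + i') := h1.2.symm.trans h2.2
    have hilen : lo k + 1 + i < w.length := by have := hplen k; have := hhilen k; omega
    have hilen' : lo k' + 1 + i' < w.length := by have := hplen k'; have := hhilen k'; omega
    have hidx := hw.eq_of_lv_eq_of_rv_eq hilen hilen' hl hr'
    have hpi := hplen k
    have hpi' := hplen k'
    rcases lt_or_gt_of_ne hkk' with hlt | hlt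
    · have := hsep k k' hlt; omega
    · have := hsep k' k hlt; omega

end Literature.Probability.Percolation

end
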